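import Summits.CriticalPhenomena.PercolationContinuityZ3.Theorems.PercNearOneGluingNoHeavyLowerTailCILRelayNeighboursSeparation
import HarnessLib

/-!
# `NoHeavyLowerTail` (stmt-CriticalPhenomena-4575) — two-member observer sets: the LIGHTER member bounds the E-mass of every vertex

Support file (prover `prim-hp-3`, hull-port line, submodularity / Rayleigh-monotonicity seat; `--supports stmt-CriticalPhenomena-4575`).
No definitions, no named facts, no sorries.

Notation: `μ_w = prodBernoulli w` on `Fin n`, relays `A`, level `j`, `π(v) = {x ∈ A : v ↔ x}`, lightness `I(v) = μ{|π(v)| ≤ j}`; for the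
observer set `O = {y, z}`: `π(O) = {x ∈ A : y ↔ x ∨ z ↔ x}` and, for a vertex `c`, the E-MASS
`E(c) := μ(c ↮ O, 1 ≤ |π(O)| ≤ j) + μ(c ↔ O, |π(c)| ≤ j)` (crux notes `run/shared/lean/prim/prim-hp-3/HULLPORT-REF-gen5.md` §1).

**Theorem (`HullPort.obsE_pair_le_lighter`).**  For `y ≠ z` with `I(z) ≤ I(y)` and EVERY vertex `c`:  `E(c) ≤ I(y)`.
So for a two-member observer set the lighter member is an "E-witness" for every vertex — with no hypothesis on `c`
(compare the quantitative observer-set transfer `HullPort.setCS_deficit_le_excess`, which bounds `E(c)` by `max(I(c), I(y))` for any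
member `y` of any `O`).  In the two-pendant-stars kernel this is the ALL-GLUED base case of (DC)/AVMAX (both stars glued to relay
blocks), and by the E-form identity it is the unglued twin of absorption monotonicity (`HullPort.lightness_drop_le_of_glue`).

Proof.  `{c ↔ O, c light} = {c ↔ y, y light} ⊔ {c ↮ y, c ↔ z, z light}` and `{c ↮ O, O bad} ⊆ {c ↮ y, c ↮ z, y light}`, while
`I(y) = μ(y light, c ↔ y) + μ(y light, c ↮ y, c ↔ z) + μ(y light, c ↮ y, c ↮ z)`; so it suffices that
`μ(c ↮ y, c ↔ z, z light) ≤ μ(c ↮ y, c ↔ z, y light)`, i.e. (after removing the common part `{y light, z light}`)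
`μ(z ↔ c, z light, y heavy) ≤ μ(z ↔ c, y light, z heavy)`.  This is the heavy/light exchange `CutObserver.hit_heavyLight_exchange`
(van den Berg–Häggström–Kahn Thm 1.5, pair `(z, y)`, `W = {c}`): `μ(T ∩ X)·μ(Y) ≤ μ(T ∩ Y)·μ(X)` with `T = {z ↔ c}`,
`X = {z light, y heavy}`, `Y = {y light, z heavy}`, combined with `μ(X) ≤ μ(Y)` (which is `I(z) ≤ I(y)`).
-/

noncomputable section

namespace Summit.CriticalPhenomena.PercolationContinuityZ3.Theorems

open MeasureTheory Set Literature.Probability.LatticeModels Literature.Probability.Percolation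
open scoped Classical BigOperators

variable {n : ℕ}

namespace HullPort

/-- **Two-member observer set: the lighter member bounds every E-mass.**  For vertices `y ≠ z` with `I(z) ≤ I(y)` and any `c`:
`μ(c ↮ {y,z}, 1 ≤ |π({y,z})| ≤ j) + μ(c ↔ {y,z}, |π(c)| ≤ j) ≤ I(y)`.
[cite: VandenbergHaggstromKahn2005, Thm. 1.5 (p. 7) — via `CutObserver.hit_heavyLight_exchange`; this work] -/
theorem obsE_pair_le_lighter (w : Sym2 (Fin n) → unitInterval) (A : Finset (Fin n)) (y z c : Fin n) (j : ℕ)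
    (hyz : y ≠ z)
    (hle : (prodBernoulli w).real {ω : BondConfig (Fin n) | (A.filter fun x => ω ∈ openConn z x).card ≤ j} ≤
      (prodBernoulli w).real {ω : BondConfig (Fin n) | (A.filter fun x => ω ∈ openConn y x).card ≤ j}) :
    (prodBernoulli w).real {ω : BondConfig (Fin n) | (∀ x ∈ ({y, z} : Finset (Fin n)), ω ∉ openConn c x) ∧
        1 ≤ (A.filter fun u => ∃ x ∈ ({y, z} : Finset (Fin n)), ω ∈ openConn x u).card ∧
        (A.filter fun u => ∃ x ∈ ({y, z} : Finset (Fin n)), ω ∈ openConn x u).card ≤ j} +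
      (prodBernoulli w).real {ω : BondConfig (Fin n) | (∃ x ∈ ({y, z} : Finset (Fin n)), ω ∈ openConn c x) ∧
        (A.filter fun u => ω ∈ openConn c u).card ≤ j} ≤
      (prodBernoulli w).real {ω : BondConfig (Fin n) | (A.filter fun x => ω ∈ openConn y x).card ≤ j} := by
  haveI : IsProbabilityMeasure (prodBernoulli w) := inferInstance
  set μ := prodBernoulli w with hμ
  have hmeas : ∀ S : Set (BondConfig (Fin n)), MeasurableSet S := fun S => (Set.toFinite S).measurableSet
  -- relay counts and events
  set Ny : BondConfig (Fin n) → ℕ := fun ω => (A.filter fun x => ω ∈ openConn y x).card with hNy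
  set Nz : BondConfig (Fin n) → ℕ := fun ω => (A.filter fun x => ω ∈ openConn z x).card with hNz
  set Nc : BondConfig (Fin n) → ℕ := fun ω => (A.filter fun x => ω ∈ openConn c x).card with hNc
  set Ry : Set (BondConfig (Fin n)) := {ω | Ny ω ≤ j} with hRy
  set Rz : Set (BondConfig (Fin n)) := {ω | Nz ω ≤ j} with hRz
  set Cy : Set (BondConfig (Fin n)) := (openConn c y : Set (BondConfig (Fin n))) with hCy
  set Cz : Set (BondConfig (Fin n)) := (openConn c z : Set (BondConfig (Fin n))) with hCz
  set Sb : Set (BondConfig (Fin n)) := {ω | (∀ x ∈ ({y, z} : Finset (Fin n)), ω ∉ openConn c x) ∧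
        1 ≤ (A.filter fun u => ∃ x ∈ ({y, z} : Finset (Fin n)), ω ∈ openConn x u).card ∧
        (A.filter fun u => ∃ x ∈ ({y, z} : Finset (Fin n)), ω ∈ openConn x u).card ≤ j} with hSb
  set Sa : Set (BondConfig (Fin n)) := {ω | (∃ x ∈ ({y, z} : Finset (Fin n)), ω ∈ openConn c x) ∧ Nc ω ≤ j}
    with hSa
  -- same cluster ⇒ same relay count
  have hsame : ∀ (ω : BondConfig (Fin n)) (a b : Fin n), ω ∈ openConn a b →
      (A.filter fun x => ω ∈ openConn a x) = (A.filter fun x => ω ∈ openConn b x) := by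
    intro ω a b hab
    have hab' : (openGraph ω).Reachable a b := hab
    exact Finset.filter_congr fun x _ =>
      ⟨fun hx => (hab'.symm.trans hx : (openGraph ω).Reachable b x),
        fun hx => (hab'.trans hx : (openGraph ω).Reachable a x)⟩
  -- (1) the attached part splits along `c ↔ y`
  have hSa_y : Sa ∩ Cy ⊆ Ry ∩ Cy := by
    rintro ω ⟨⟨-, hc⟩, hcy⟩
    refine ⟨?_, hcy⟩
    simp only [hRy, mem_setOf_eq, hNy]
    have e := hsame ω c y hcy
    simp only [hNc] at hc
    rw [e] at hc
    exact hc
  have hSa_z : Sa \ Cy ⊆ (Rz \ Cy) ∩ Cz := by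
    rintro ω ⟨⟨hx, hc⟩, hcy⟩
    have hcz : ω ∈ Cz := by
      obtain ⟨x, hxO, hx⟩ := hx
      rcases Finset.mem_insert.1 hxO with rfl | hxz
      · exact absurd hx hcy
      · rw [Finset.mem_singleton] at hxz; subst hxz; exact hx
    refine ⟨⟨?_, hcy⟩, hcz⟩
    simp only [hRz, mem_setOf_eq, hNz]
    have e := hsame ω c z hcz
    simp only [hNc] at hc
    rw [e] at hc
    exact hc
  -- (2) the separated part lies in `{y light} ∖ (Cy ∪ Cz)`
  have hSb_sub : Sb ⊆ (Ry \ Cy) \ Cz := by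
    rintro ω ⟨hsep, -, hU⟩
    have hy : ω ∉ Cy := hsep y (by simp)
    have hz : ω ∉ Cz := hsep z (by simp)
    refine ⟨⟨?_, hy⟩, hz⟩
    simp only [hRy, mem_setOf_eq, hNy]
    refine le_trans (Finset.card_le_card ?_) hU
    intro x hx
    rw [Finset.mem_filter] at hx ⊢
    exact ⟨hx.1, y, by simp, hx.2⟩
  -- (3) the key exchange: μ((Rz ∖ Cy) ∩ Cz) ≤ μ((Ry ∖ Cy) ∩ Cz)
  have hkey : μ.real ((Rz \ Cy) ∩ Cz) ≤ μ.real ((Ry \ Cy) ∩ Cz) := by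
    -- split both along the other member's lightness
    have s1 := measureReal_inter_add_sdiff (μ := μ) (s := (Rz \ Cy) ∩ Cz) (hmeas Ry)
    have s2 := measureReal_inter_add_sdiff (μ := μ) (s := (Ry \ Cy) ∩ Cz) (hmeas Rz)
    have ecommon : (Rz \ Cy) ∩ Cz ∩ Ry = (Ry \ Cy) ∩ Cz ∩ Rz := by
      ext ω; simp only [mem_inter_iff, mem_sdiff]; tauto
    -- the two remainders are the exchange events
    have hfilt : ∀ (ω : BondConfig (Fin n)) (v : Fin n),
        (A.filter fun x => (openGraph ω).Reachable v x) = (A.filter fun x => ω ∈ openConn v x) :=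
      fun ω v => Finset.filter_congr (fun x _ => Iff.rfl)
    set T : Set (BondConfig (Fin n)) := {ω | ∃ m ∈ ({c} : Finset (Fin n)), (openGraph ω).Reachable z m} with hT
    set X : Set (BondConfig (Fin n)) := {ω | Nz ω ≤ j ∧ j < Ny ω} with hX
    set Y' : Set (BondConfig (Fin n)) := {ω | Ny ω ≤ j ∧ j < Nz ω} with hY'
    have hTz : ∀ ω : BondConfig (Fin n), ω ∈ T ↔ ω ∈ Cz := by
      intro ω
      simp only [hT, mem_setOf_eq, Finset.mem_singleton, exists_eq_left, hCz]
      exact ⟨fun h => (h.symm : (openGraph ω).Reachable c z), fun h => ((h : (openGraph ω).Reachable c z).symm)⟩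
    have hnot : ∀ ω : BondConfig (Fin n), ω ∈ Cz → Nz ω ≤ j → j < Ny ω → ω ∉ Cy := by
      intro ω h3 h1 h4 hcy
      have e1 := hsame ω c y hcy
      have e2 := hsame ω c z h3
      have e : Ny ω = Nz ω := by
        simp only [hNy, hNz]; rw [← e1, e2]
      omega
    have hnot' : ∀ ω : BondConfig (Fin n), ω ∈ Cz → Ny ω ≤ j → j < Nz ω → ω ∉ Cy := by
      intro ω h3 h1 h4 hcy
      have e1 := hsame ω c y hcy
      have e2 := hsame ω c z h3
      have e : Ny ω = Nz ω := by
        simp only [hNy, hNz]; rw [← e1, e2]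
      omega
    have eX : ((Rz \ Cy) ∩ Cz) \ Ry = T ∩ X := by
      ext ω
      simp only [mem_inter_iff, mem_sdiff, hRz, hRy, hX, mem_setOf_eq, not_le, hTz ω]
      constructor
      · rintro ⟨⟨⟨h1, -⟩, h3⟩, h4⟩; exact ⟨h3, h1, h4⟩
      · rintro ⟨h3, h1, h4⟩; exact ⟨⟨⟨h1, hnot ω h3 h1 h4⟩, h3⟩, h4⟩
    have eY : ((Ry \ Cy) ∩ Cz) \ Rz = T ∩ Y' := by
      ext ω
      simp only [mem_inter_iff, mem_sdiff, hRz, hRy, hY', mem_setOf_eq, not_le, hTz ω]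
      constructor
      · rintro ⟨⟨⟨h1, -⟩, h3⟩, h4⟩; exact ⟨h3, h1, h4⟩
      · rintro ⟨h3, h1, h4⟩; exact ⟨⟨⟨h1, hnot' ω h3 h1 h4⟩, h3⟩, h4⟩
    -- the exchange inequality (BHK Thm 1.5, pair (z, y), W = {c}) and the comparison μ(X) ≤ μ(Y')
    have hexch : μ.real (T ∩ X) * μ.real Y' ≤ μ.real (T ∩ Y') * μ.real X := by
      have h := CutObserver.hit_heavyLight_exchange w A (Ne.symm hyz) ({c} : Finset (Fin n)) j
      simp only [hfilt] at h
      rw [hT, hX, hY']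
      exact h
    have hXY : μ.real X ≤ μ.real Y' := by
      have t1 := measureReal_inter_add_sdiff (μ := μ) (s := Rz) (hmeas Ry)
      have t2 := measureReal_inter_add_sdiff (μ := μ) (s := Ry) (hmeas Rz)
      have e3 : Rz ∩ Ry = Ry ∩ Rz := inter_comm _ _
      have e4 : Rz \ Ry = X := by
        ext ω; simp only [hRz, hRy, hX, mem_sdiff, mem_setOf_eq, not_le]
      have e5 : Ry \ Rz = Y' := by
        ext ω; simp only [hRz, hRy, hY', mem_sdiff, mem_setOf_eq, not_le]
      rw [e3, e4] at t1
      rw [e5] at t2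
      have hle' : μ.real Rz ≤ μ.real Ry := hle
      linarith
    have hrem : μ.real (T ∩ X) ≤ μ.real (T ∩ Y') := by
      have hTX_le_X : μ.real (T ∩ X) ≤ μ.real X := measureReal_mono inter_subset_right
      by_cases hY0 : μ.real Y' = 0
      · have hX0 : μ.real X ≤ 0 := by rw [hY0] at hXY; exact hXY
        linarith [measureReal_nonneg (μ := μ) (s := T ∩ Y'), measureReal_nonneg (μ := μ) (s := T ∩ X)]
      · have hYpos : 0 < μ.real Y' := lt_of_le_of_ne measureReal_nonneg (Ne.symm hY0)
        have hb : 0 ≤ μ.real (T ∩ Y') := measureReal_nonneg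
        have h2 : μ.real (T ∩ Y') * μ.real X ≤ μ.real (T ∩ Y') * μ.real Y' :=
          mul_le_mul_of_nonneg_left hXY hb
        have h3 : μ.real (T ∩ X) * μ.real Y' ≤ μ.real (T ∩ Y') * μ.real Y' := le_trans hexch h2
        exact le_of_mul_le_mul_right h3 hYpos
    rw [eX] at s1
    rw [eY] at s2
    rw [ecommon] at s1
    linarith
  -- (4) assemble
  have hSa_split := measureReal_inter_add_sdiff (μ := μ) (s := Sa) (hmeas Cy)
  have hRy1 := measureReal_inter_add_sdiff (μ := μ) (s := Ry) (hmeas Cy)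
  have hRy2 := measureReal_inter_add_sdiff (μ := μ) (s := Ry \ Cy) (hmeas Cz)
  have m1 : μ.real (Sa ∩ Cy) ≤ μ.real (Ry ∩ Cy) := measureReal_mono hSa_y
  have m2 : μ.real (Sa \ Cy) ≤ μ.real ((Rz \ Cy) ∩ Cz) := measureReal_mono hSa_z
  have m3 : μ.real Sb ≤ μ.real ((Ry \ Cy) \ Cz) := measureReal_mono hSb_sub
  change μ.real Sb + μ.real Sa ≤ μ.real Ry
  linarith

end HullPort

end Summit.CriticalPhenomena.PercolationContinuityZ3.Theorems

end
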